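import Summits.QuantumFields.BalabanUV.Beta.GAN24.Push3
import Summits.QuantumFields.BalabanUV.Beta.GAN24.ContactOneGaugeCellAlgebra
import Summits.QuantumFields.BalabanUV.Beta.GAN24.ContactOneGaugeCellMaxwell

/-!
# `BalabanUV.Beta.GAN24.Push3GaugeSlotCells` — binder row G-an2-4 / (CONV-C), the row owner's CONTACT-TERM ROUTE (`HOME/b2b-balaban-gan24-p1/gen17/CT-ROUTE-v1.md`
# §3, `gen18/CT3-MECHANISM.md` v1.1 §(c)), module CT-3c §2: A PURE-GAUGE LEG FAMILY `dz λ` IN ANY ONE OF THE THREE SLOTS OF THE PUSH `push₃ l r w (wilsonA d)`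
# OF THE CUBIC WILSON TABLE READS, ENTRY BY ENTRY, AS leaf-02's ONE-GAUGE CELL SUM (`ContactOneGaugeCellTable.cell_eq'` ∕ `cellIdx_eq'` shape).

NOT IN PRINT; OUR BOOKKEEPING (G-an2-4 formalisation swarm, leaf prover `b2b-balaban-gan24-formalise-leaf-01`, gen 58; offered to the row owner gan24-p1-g18
with the §1 module `Push3LegTelescope`, journal `CLAIMS.log` l.31499; names PROVISIONAL).  HONEST FRAMING (cell contract, verbatim): «discharging `BetaPertH`
makes Bałaban's UV stability UNCONDITIONAL — a real constructive-QFT result; it is NOT the continuum limit and NOT the Clay problem.»  HONEST DEPENDENCY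
(verbatim): «continuum YM on T⁴ ⇐ BetaPertH ∧ nine spine estimates (0/9 proved); BetaPertH ⇐ (D1) ∧ (D4) ∧ CAP+tail; G-an2-4 gates asym, D1 and NE2/3/4.»

WHAT.  After `Push3LegTelescope.push₃_telescope`, the contact term of the cubic read-out is a sum of three pushes `push₃ l r w (wilsonA d) κ′ u′` in each of
which exactly ONE leg family is a pure gauge `(μ, y) ↦ dz (λ μ y)` (the gauge function `λ μ y : Site → ℝ` of the coarse bond `(μ, y)`; leaf-01 g57's
`DressedLegUnits.legAct_legChain_eq_add_dz`).  leaf-02's CT-1 ∕ CT-3a files evaluate the cubic Wilson table against ONE pure-gauge leg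
(`ContactOneGaugeCellAlgebra.tsum_dz_mul_wilsonA` ∕ `tsum_wilsonA_mul_dz` ∕ `tsum_dz_mul_wilsonA_idx`) and bound the resulting ONE-GAUGE CELL in the nesting
«partner leg OUTER, index leg INSIDE» (`ContactOneGaugeCellTable.cell_eq'`, `cellIdx_eq'`).  This module carries the `push₃` entry formula
(`Push3.push₃_inl_inl`: right leg outer, left leg middle, table vertex inner) INTO that nesting, slot by slot:
* §1 locality bookkeeping of the cubic Wilson table as a `push₃` table family: windows `cube 2` (index site about the right site) and `cube 4` (left site about
  the right site), vanishing of `vertexW w (wilsonA d)` outside the window, antisymmetry `vertexW_wilsonA_antisymm`, and two finitely-supported Fubini lemmas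
  (`tsum_tsum_comm_of_windows`, `tsum_comm_of_window`).
* §2 TABLE SLOT (hypothesis-free): **`push₃_gaugeTable_ff`** —
  `push₃ l r (dz λ) (wilsonA d) κ′ u′ x′ z′ (inl α) (inl β) = Σ'_z Σ_b r β z′ b z · Σ'_x Σ_a l α x′ a x · (½(λ_{κ′u′} z − λ_{κ′u′} x)·(d*dδ_{(b,z)})_a x)`
  = the LHS of `cellIdx_eq'` with `(TR, TL, ψ) = (r β z′, l α x′, λ κ′ u′)`.
* §3 LEFT SLOT (hypothesis-free; one finite exchange): **`push₃_gaugeLeft_ff`** —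
  `push₃ (dz λ) r w (wilsonA d) κ′ u′ x′ z′ (inl α) (inl β) = Σ'_z Σ_b r β z′ b z · Σ'_u Σ_κ w κ′ u′ κ u · (½(λ_{αx′}(u+e_κ) − ½(λ_{αx′} z + λ_{αx′}(z+e_b)))·(d*dδ_{(κ,u)})_b z)`
  = the LHS of `cell_eq'` with `(T₃, T₁, ψ) = (r β z′, w κ′ u′, λ α x′)`.
* §4 TRANSPOSITION ON THE SUMMABLE CLASS (one genuine exchange of two lattice sums, by finite windows and shifts): **`push₃_transpose_ff`** —
  `push₃ l r w (wilsonA d) κ′ u′ x′ z′ (inl α) (inl β) = −push₃ r l w (wilsonA d) κ′ u′ z′ x′ (inl β) (inl α)` (left legs with SUMMABLE fine rows, right and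
  table legs BOUNDED) — the cubic Wilson table's antisymmetry `StepJetData.wilsonA_antisymm` lifted to the push; hence the RIGHT SLOT
  **`push₃_gaugeRight_ff`** = minus the left-slot cell with the legs exchanged.
[folklore] throughout: finite-window ∕ dominated-`tsum` bookkeeping over leaf-17's `Push4`, leaf-01's `Push3`, leaf-02's `ContactOneGaugeCellAlgebra` ∕
`ContactOneGaugeCellMaxwell` and lit-balaban's `StepJetData` BY NAME; 0 `def`, 0 cited facts, 0 `def … : Prop`, 0 sorry.  NO estimate; discharges NOTHING of
(hS, hSall) on (E); NOT CT-3c's bounds (leaf-02's `abs_cell_le'` ∕ the owner's `Staircase*` supply them); 0 wall binders; NEVER «G-an2-4 closed»; NOT D1, NOT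
BetaPertH, NOT continuum, NOT Clay.
-/

noncomputable section

open Finset
open scoped BigOperators
open Literature.MathematicalPhysics.QuantumFieldTheory
open Literature.MathematicalPhysics.QuantumFieldTheory.Balaban1983to89
open Literature.MathematicalPhysics.QuantumFieldTheory.Balaban1983to89.Beta
open B12Sec2to5 (l1 l1_nonneg)
open ExpKernelCalculus (MKer Decays comp Zl Zl_nonneg l1_sub_triangle l1_sub_symm)
open OneStepResolventKernel (Fib LocStencil)
open StepJetData (wilsonA wilsonA_antisymm wEntry wEntry_eq_zero_or locStencil_wilsonA)
open AffineAveraging (Form1 dz curv curvAdj)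
open B6BondElimination (unitVec)
open KKTFluctuationKernel (delta1)
open Summit.QuantumFields.BalabanUV.Beta.AxialDressingRooted (cube mem_cube)
open Summit.QuantumFields.BalabanUV.Beta.GAN24.Push4 (vertexW vertexW_apply)
open Summit.QuantumFields.BalabanUV.Beta.GAN24.Push4NestAux (decays_vertexW_of_locStencil abs_le_of_decays)
open Summit.QuantumFields.BalabanUV.Beta.GAN24.Push3 (push₃ push₃_inl_inl)
open Summit.QuantumFields.BalabanUV.Beta.GAN24.ContactOneGaugeCellAlgebra (tsum_dz_mul_wilsonA tsum_dz_mul_wilsonA_idx summable_mul_wilsonA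
  summable_mul_wilsonA_idx wilsonA_inl_inl_eq_zero_of_lt_right abs_apply_le_l1 mem_cube_two_of_l1_le)
open Summit.QuantumFields.BalabanUV.Beta.GAN24.ContactOneGaugeCellMaxwell (curvAdj_curv_delta1_eq_zero_of_not_mem)

namespace Summit.QuantumFields.BalabanUV.Beta.GAN24.Push3GaugeSlotCells

variable {d : ℕ}
variable (l r w : Fin (d + 1) → (Fin (d + 1) → ℤ) → Fin (d + 1) → (Fin (d + 1) → ℤ) → ℝ)
variable (lam : Fin (d + 1) → (Fin (d + 1) → ℤ) → (Fin (d + 1) → ℤ) → ℝ)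

/-! ## §1 Locality bookkeeping of the cubic Wilson table as a `push₃` table family -/

/-- [folklore] An `ℓ¹` ball of radius `R` sits inside the window `cube R`. -/
theorem mem_cube_of_l1_le {R : ℕ} {v : Fin (d + 1) → ℤ} (hv : l1 v ≤ R) : v ∈ cube (d + 1) R := by
  refine mem_cube.2 fun i => ?_
  have h := (abs_apply_le_l1 v i).trans hv
  exact_mod_cast h

/-- [folklore] The cubic Wilson table vanishes unless the RIGHT site is in the window `cube 2` of the INDEX site: `z − u ∉ cube 2 ⟹ W κ u x z a b = 0`. -/
theorem wilsonA_ff_eq_zero_of_not_mem_idx {κ : Fin (d + 1)} {u x z : Fin (d + 1) → ℤ} {a b : Fin (d + 1)} (hu : z - u ∉ cube (d + 1) 2) :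
    wilsonA d κ u x z (Sum.inl a) (Sum.inl b) = 0 :=
  wilsonA_inl_inl_eq_zero_of_lt_right κ u x z a b (not_le.1 fun h => hu (mem_cube_two_of_l1_le h))

/-- [folklore] The cubic Wilson table vanishes unless the LEFT site is in the window `cube 4` of the RIGHT site: `x − z ∉ cube 4 ⟹ W κ u x z a b = 0`
(both sites lie within `ℓ¹`-distance `2` of the index site — lit-balaban's `StepJetData.wEntry_eq_zero_or`). -/
theorem wilsonA_ff_eq_zero_of_not_mem_left {κ : Fin (d + 1)} {u x z : Fin (d + 1) → ℤ} {a b : Fin (d + 1)} (hx : x - z ∉ cube (d + 1) 4) :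
    wilsonA d κ u x z (Sum.inl a) (Sum.inl b) = 0 := by
  have hxz : ¬(l1 (x - u) ≤ 2 ∧ l1 (z - u) ≤ 2) := by
    rintro ⟨h1, h2⟩
    refine hx (mem_cube_of_l1_le ?_)
    have t := l1_sub_triangle x u z
    rw [l1_sub_symm u z] at t
    have h4 : l1 (x - z) ≤ 4 := by linarith
    exact_mod_cast h4
  have e1 : wEntry d κ u x z a b = 0 := (wEntry_eq_zero_or κ u x z a b).resolve_right hxz
  have e2 : wEntry d κ u z x b a = 0 := (wEntry_eq_zero_or κ u z x b a).resolve_right fun h => hxz ⟨h.2, h.1⟩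
  show (1 / 2 : ℝ) * (wEntry d κ u x z a b - wEntry d κ u z x b a) = 0
  rw [e1, e2, sub_zero, mul_zero]

/-- [folklore] Hence the table vertex of the cubic Wilson family through ANY table legs vanishes outside the window: `x − z ∉ cube 4 ⟹
vertexW w (wilsonA d) κ′ u′ x z a b = 0` on field indices. -/
theorem vertexW_wilsonA_ff_eq_zero_of_not_mem (κ' : Fin (d + 1)) (u' : Fin (d + 1) → ℤ) {x z : Fin (d + 1) → ℤ} {a b : Fin (d + 1)}
    (hx : x - z ∉ cube (d + 1) 4) : vertexW w (wilsonA d) κ' u' x z (Sum.inl a) (Sum.inl b) = 0 := by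
  rw [vertexW_apply]
  refine Finset.sum_eq_zero fun κ _ => ?_
  have h0 : ∀ u, w κ' u' κ u * wilsonA d κ u x z (Sum.inl a) (Sum.inl b) = 0 := fun u => by
    rw [wilsonA_ff_eq_zero_of_not_mem_left hx, mul_zero]
  simp only [h0, tsum_zero]

/-- [folklore] **THE TABLE VERTEX OF THE CUBIC WILSON FAMILY IS ANTISYMMETRIC** under the exchange of its two kernel slots (lit-balaban's
`StepJetData.wilsonA_antisymm` under the index sum): `vertexW w (wilsonA d) κ′ u′ z x b a = −vertexW w (wilsonA d) κ′ u′ x z a b`. -/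
theorem vertexW_wilsonA_antisymm (κ' : Fin (d + 1)) (u' x z : Fin (d + 1) → ℤ) (a b : Fib d) :
    vertexW w (wilsonA d) κ' u' z x b a = -vertexW w (wilsonA d) κ' u' x z a b := by
  rw [vertexW_apply, vertexW_apply, ← Finset.sum_neg_distrib]
  refine Finset.sum_congr rfl fun κ _ => ?_
  rw [← tsum_neg]
  exact tsum_congr fun u => by rw [wilsonA_antisymm κ u x z a b]; ring

/-- [folklore] (Fubini, finitely supported) Two lattice sums of a function supported in a finite window IN EACH VARIABLE commute. -/
theorem tsum_tsum_comm_of_windows {Φ : (Fin (d + 1) → ℤ) → (Fin (d + 1) → ℤ) → ℝ} (X U : Finset (Fin (d + 1) → ℤ))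
    (hX : ∀ x ∉ X, ∀ u, Φ x u = 0) (hU : ∀ u ∉ U, ∀ x, Φ x u = 0) : ∑' x, ∑' u, Φ x u = ∑' u, ∑' x, Φ x u := by
  have h1 : ∀ x, ∑' u, Φ x u = ∑ u ∈ U, Φ x u := fun x => tsum_eq_sum fun u hu => hU u hu x
  have h2 : ∀ u, ∑' x, Φ x u = ∑ x ∈ X, Φ x u := fun u => tsum_eq_sum fun x hx => hX x hx u
  simp only [h1, h2]
  rw [tsum_eq_sum (s := X) fun x hx => Finset.sum_eq_zero fun u _ => hX x hx u,
    tsum_eq_sum (s := U) fun u hu => Finset.sum_eq_zero fun x _ => hU u hu x, Finset.sum_comm]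

/-- [folklore] (Fubini, one window + summability along the diagonal) Two lattice sums of a function `Θ x z` supported in `x − z ∈ T` (a finite window) and
summable along every shifted diagonal `z ↦ Θ (z + t) z`, `t ∈ T`, commute: `Σ'_z Σ'_x Θ x z = Σ'_x Σ'_z Θ x z`. -/
theorem tsum_comm_of_window {Θ : (Fin (d + 1) → ℤ) → (Fin (d + 1) → ℤ) → ℝ} (T : Finset (Fin (d + 1) → ℤ))
    (hT : ∀ x z, x - z ∉ T → Θ x z = 0) (hsum : ∀ t ∈ T, Summable fun z => Θ (z + t) z) :
    ∑' z, ∑' x, Θ x z = ∑' x, ∑' z, Θ x z := by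
  classical
  have hx : ∀ z, ∑' x, Θ x z = ∑ t ∈ T, Θ (z + t) z := by
    intro z
    rw [tsum_eq_sum (s := T.image fun t => z + t) (fun x hx' => hT x z fun h => hx' (Finset.mem_image.2 ⟨x - z, h, by abel⟩)),
      Finset.sum_image (fun t₁ _ t₂ _ h => add_left_cancel h)]
  have hz : ∀ x, ∑' z, Θ x z = ∑ t ∈ T, Θ x (x - t) := by
    intro x
    rw [tsum_eq_sum (s := T.image fun t => x - t) (fun z hz' => hT x z fun h => hz' (Finset.mem_image.2 ⟨x - z, h, by abel⟩)),
      Finset.sum_image (fun t₁ _ t₂ _ h => sub_right_injective h)]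
  have hsum' : ∀ t ∈ T, Summable fun x => Θ x (x - t) := by
    intro t ht
    have e : ((fun x => Θ x (x - t)) ∘ (Equiv.addRight t)) = fun z => Θ (z + t) z := by
      funext z; simp only [Function.comp_apply, Equiv.coe_addRight, add_sub_cancel_right]
    exact (Equiv.addRight t).summable_iff.1 (e ▸ hsum t ht)
  rw [tsum_congr hx, tsum_congr hz, Summable.tsum_finsetSum hsum, Summable.tsum_finsetSum hsum']
  refine Finset.sum_congr rfl fun t _ => ?_
  rw [← (Equiv.addRight t).tsum_eq (fun x => Θ x (x - t))]
  exact tsum_congr fun z => by simp only [Equiv.coe_addRight, add_sub_cancel_right]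

/-! ## §2 THE TABLE SLOT: a pure-gauge TABLE leg family reads as leaf-02's index cell (hypothesis-free) -/

/-- [folklore] The table vertex of the cubic Wilson family through the pure-gauge table legs `(μ, y) ↦ dz (λ μ y)` is leaf-02's index-slot bracket
(`ContactOneGaugeCellAlgebra.tsum_dz_mul_wilsonA_idx` under the finite direction sum):
`vertexW (dz λ) (wilsonA d) κ′ u′ x z a b = ½·(λ_{κ′u′} z − λ_{κ′u′} x)·(d*dδ_{(b,z)})_a x`. -/
theorem vertexW_dz_wilsonA_ff (κ' : Fin (d + 1)) (u' x z : Fin (d + 1) → ℤ) (a b : Fin (d + 1)) :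
    vertexW (fun μ y κ u => dz (lam μ y) κ u) (wilsonA d) κ' u' x z (Sum.inl a) (Sum.inl b)
      = (1 / 2 : ℝ) * (lam κ' u' z - lam κ' u' x) * curvAdj (curv (delta1 b z)) a x := by
  rw [vertexW_apply, ← tsum_dz_mul_wilsonA_idx x z a b (lam κ' u')]
  exact (Summable.tsum_finsetSum fun κ _ => summable_mul_wilsonA_idx κ x z a b (dz (lam κ' u') κ)).symm

/-- [folklore] **THE TABLE SLOT** (hypothesis-free): with a pure-gauge TABLE leg family, every field entry of the push is leaf-02's INDEX CELL SUM
(`ContactOneGaugeCellTable.cellIdx_eq'` with `TR = r β z′`, `TL = l α x′`, `ψ = λ κ′ u′`):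
`push₃ l r (dz λ) (wilsonA d) κ′ u′ x′ z′ (inl α) (inl β) = Σ'_z Σ_b r β z′ b z · Σ'_x Σ_a l α x′ a x · (½(λ_{κ′u′} z − λ_{κ′u′} x)·(d*dδ_{(b,z)})_a x)`. -/
theorem push₃_gaugeTable_ff (κ' : Fin (d + 1)) (u' x' z' : Fin (d + 1) → ℤ) (α β : Fin (d + 1)) :
    push₃ l r (fun μ y κ u => dz (lam μ y) κ u) (wilsonA d) κ' u' x' z' (Sum.inl α) (Sum.inl β)
      = ∑' z, ∑ b, r β z' b z * ∑' x, ∑ a, l α x' a x * ((1 / 2 : ℝ) * (lam κ' u' z - lam κ' u' x) * curvAdj (curv (delta1 b z)) a x) := by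
  rw [push₃_inl_inl]
  refine tsum_congr fun z => Finset.sum_congr rfl fun b _ => ?_
  rw [mul_comm]
  congr 1
  refine tsum_congr fun x => Finset.sum_congr rfl fun a _ => ?_
  rw [vertexW_dz_wilsonA_ff]

/-! ## §3 THE LEFT SLOT: a pure-gauge LEFT leg family reads as leaf-02's first-slot cell (hypothesis-free; one finite exchange) -/

/-- [folklore] **THE LEFT LEG AGAINST THE TABLE VERTEX, INDEX LEG OUTSIDE** (one exchange of two FINITELY supported lattice sums — the left site and the
index site both lie in fixed windows about the right site — then leaf-02's `tsum_dz_mul_wilsonA` under the binders):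
`Σ'_x Σ_a (dz ψ)_a x · vertexW w (wilsonA d) κ′ u′ x z a b = Σ'_u Σ_κ w κ′ u′ κ u · (½(ψ(u+e_κ) − ½(ψ z + ψ(z+e_b)))·(d*dδ_{(κ,u)})_b z)`. -/
theorem inner_gaugeLeft_ff (ψ : (Fin (d + 1) → ℤ) → ℝ) (κ' : Fin (d + 1)) (u' z : Fin (d + 1) → ℤ) (b : Fin (d + 1)) :
    ∑' x, ∑ a, dz ψ a x * vertexW w (wilsonA d) κ' u' x z (Sum.inl a) (Sum.inl b)
      = ∑' u, ∑ κ, w κ' u' κ u *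
          ((1 / 2 : ℝ) * (ψ (u + unitVec κ) - (ψ z + ψ (z + unitVec b)) / 2) * curvAdj (curv (delta1 κ u)) b z) := by
  classical
  -- the summand of the double sum and its two finite windows about the right site `z`
  have hsu : ∀ x a κ, Summable fun u => dz ψ a x * (w κ' u' κ u * wilsonA d κ u x z (Sum.inl a) (Sum.inl b)) := by
    intro x a κ
    refine summable_of_ne_finset_zero (s := (cube (d + 1) 2).image fun v => z - v) fun u hu => ?_
    have hu' : z - u ∉ cube (d + 1) 2 := fun h => hu (Finset.mem_image.2 ⟨z - u, h, by abel⟩)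
    rw [wilsonA_ff_eq_zero_of_not_mem_idx hu', mul_zero, mul_zero]
  have hsx : ∀ u a κ, Summable fun x => dz ψ a x * (w κ' u' κ u * wilsonA d κ u x z (Sum.inl a) (Sum.inl b)) := by
    intro u a κ
    refine summable_of_ne_finset_zero (s := (cube (d + 1) 4).image fun t => z + t) fun x hx => ?_
    have hx' : x - z ∉ cube (d + 1) 4 := fun h => hx (Finset.mem_image.2 ⟨x - z, h, by abel⟩)
    rw [wilsonA_ff_eq_zero_of_not_mem_left hx', mul_zero, mul_zero]
  -- the left-hand side as an iterated sum `Σ'_x Σ'_u Φ x u`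
  have hL : ∀ x, (∑ a, dz ψ a x * vertexW w (wilsonA d) κ' u' x z (Sum.inl a) (Sum.inl b))
      = ∑' u, ∑ a, ∑ κ, dz ψ a x * (w κ' u' κ u * wilsonA d κ u x z (Sum.inl a) (Sum.inl b)) := by
    intro x
    calc (∑ a, dz ψ a x * vertexW w (wilsonA d) κ' u' x z (Sum.inl a) (Sum.inl b))
        = ∑ a, ∑ κ, ∑' u, dz ψ a x * (w κ' u' κ u * wilsonA d κ u x z (Sum.inl a) (Sum.inl b)) := by
          refine Finset.sum_congr rfl fun a _ => ?_
          rw [vertexW_apply, Finset.mul_sum]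
          refine Finset.sum_congr rfl fun κ _ => ?_
          rw [← tsum_mul_left]
      _ = ∑ a, ∑' u, ∑ κ, dz ψ a x * (w κ' u' κ u * wilsonA d κ u x z (Sum.inl a) (Sum.inl b)) := by
          refine Finset.sum_congr rfl fun a _ => ?_
          rw [Summable.tsum_finsetSum fun κ _ => hsu x a κ]
      _ = _ := by rw [Summable.tsum_finsetSum fun a _ => summable_sum fun κ _ => hsu x a κ]
  -- the right-hand side as the iterated sum `Σ'_u Σ'_x Φ x u`
  have hR : ∀ u, (∑ κ, w κ' u' κ u * ∑' x, ∑ a, dz ψ a x * wilsonA d κ u x z (Sum.inl a) (Sum.inl b))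
      = ∑' x, ∑ a, ∑ κ, dz ψ a x * (w κ' u' κ u * wilsonA d κ u x z (Sum.inl a) (Sum.inl b)) := by
    intro u
    have hs1 : ∀ κ a, Summable fun x => dz ψ a x * wilsonA d κ u x z (Sum.inl a) (Sum.inl b) :=
      fun κ a => summable_mul_wilsonA κ u z a b (dz ψ a)
    calc (∑ κ, w κ' u' κ u * ∑' x, ∑ a, dz ψ a x * wilsonA d κ u x z (Sum.inl a) (Sum.inl b))
        = ∑ κ, ∑ a, ∑' x, dz ψ a x * (w κ' u' κ u * wilsonA d κ u x z (Sum.inl a) (Sum.inl b)) := by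
          refine Finset.sum_congr rfl fun κ _ => ?_
          rw [Summable.tsum_finsetSum fun a _ => hs1 κ a, Finset.mul_sum]
          refine Finset.sum_congr rfl fun a _ => ?_
          rw [← tsum_mul_left]
          exact tsum_congr fun x => by ring
      _ = ∑ a, ∑ κ, ∑' x, dz ψ a x * (w κ' u' κ u * wilsonA d κ u x z (Sum.inl a) (Sum.inl b)) := Finset.sum_comm
      _ = ∑ a, ∑' x, ∑ κ, dz ψ a x * (w κ' u' κ u * wilsonA d κ u x z (Sum.inl a) (Sum.inl b)) := by
          refine Finset.sum_congr rfl fun a _ => ?_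
          rw [Summable.tsum_finsetSum fun κ _ => hsx u a κ]
      _ = _ := by rw [Summable.tsum_finsetSum fun a _ => summable_sum fun κ _ => hsx u a κ]
  -- exchange the two finitely supported sums
  have hX : ∀ x ∉ (cube (d + 1) 4).image (fun t => z + t), ∀ u,
      (∑ a, ∑ κ, dz ψ a x * (w κ' u' κ u * wilsonA d κ u x z (Sum.inl a) (Sum.inl b))) = 0 := by
    intro x hx u
    have hx' : x - z ∉ cube (d + 1) 4 := fun h => hx (Finset.mem_image.2 ⟨x - z, h, by abel⟩)
    refine Finset.sum_eq_zero fun a _ => Finset.sum_eq_zero fun κ _ => ?_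
    rw [wilsonA_ff_eq_zero_of_not_mem_left hx', mul_zero, mul_zero]
  have hU : ∀ u ∉ (cube (d + 1) 2).image (fun v => z - v), ∀ x,
      (∑ a, ∑ κ, dz ψ a x * (w κ' u' κ u * wilsonA d κ u x z (Sum.inl a) (Sum.inl b))) = 0 := by
    intro u hu x
    have hu' : z - u ∉ cube (d + 1) 2 := fun h => hu (Finset.mem_image.2 ⟨z - u, h, by abel⟩)
    refine Finset.sum_eq_zero fun a _ => Finset.sum_eq_zero fun κ _ => ?_
    rw [wilsonA_ff_eq_zero_of_not_mem_idx hu', mul_zero, mul_zero]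
  rw [tsum_congr hL, tsum_tsum_comm_of_windows (Φ := fun x u => ∑ a, ∑ κ, dz ψ a x * (w κ' u' κ u * wilsonA d κ u x z (Sum.inl a) (Sum.inl b)))
    _ _ hX hU]
  refine tsum_congr fun u => ?_
  rw [← hR u]
  refine Finset.sum_congr rfl fun κ _ => ?_
  rw [tsum_dz_mul_wilsonA κ u z b ψ]

/-- [folklore] **THE LEFT SLOT** (hypothesis-free): with a pure-gauge LEFT leg family, every field entry of the push is leaf-02's FIRST-SLOT CELL SUM
(`ContactOneGaugeCellTable.cell_eq'` with `T₃ = r β z′` OUTER, `T₁ = w κ′ u′` INSIDE, `ψ = λ α x′`):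
`push₃ (dz λ) r w (wilsonA d) κ′ u′ x′ z′ (inl α) (inl β) = Σ'_z Σ_b r β z′ b z · Σ'_u Σ_κ w κ′ u′ κ u · (½(λ_{αx′}(u+e_κ) − ½(λ_{αx′} z + λ_{αx′}(z+e_b)))·(d*dδ_{(κ,u)})_b z)`. -/
theorem push₃_gaugeLeft_ff (κ' : Fin (d + 1)) (u' x' z' : Fin (d + 1) → ℤ) (α β : Fin (d + 1)) :
    push₃ (fun μ y κ u => dz (lam μ y) κ u) r w (wilsonA d) κ' u' x' z' (Sum.inl α) (Sum.inl β)
      = ∑' z, ∑ b, r β z' b z * ∑' u, ∑ κ, w κ' u' κ u *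
          ((1 / 2 : ℝ) * (lam α x' (u + unitVec κ) - (lam α x' z + lam α x' (z + unitVec b)) / 2) * curvAdj (curv (delta1 κ u)) b z) := by
  rw [push₃_inl_inl]
  refine tsum_congr fun z => Finset.sum_congr rfl fun b _ => ?_
  rw [mul_comm, inner_gaugeLeft_ff w (lam α x') κ' u' z b]

/-! ## §4 TRANSPOSITION ON THE SUMMABLE CLASS, and the RIGHT SLOT -/

variable {l r w lam}

/-- [folklore] **THE PUSH OF THE CUBIC WILSON TABLE IS ANTISYMMETRIC UNDER THE EXCHANGE OF ITS TWO KERNEL LEGS** (with the coarse arguments exchanged),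
ON THE SUMMABLE CLASS: left legs `l` with SUMMABLE fine rows, right legs `r` BOUNDED, table legs `w` BOUNDED ⟹
`push₃ l r w (wilsonA d) κ′ u′ x′ z′ (inl α) (inl β) = −push₃ r l w (wilsonA d) κ′ u′ z′ x′ (inl β) (inl α)`.
(lit-balaban's `wilsonA_antisymm` entrywise + ONE genuine exchange of the two kernel-leg sums, `tsum_comm_of_window` on the window `cube 4` with the
shifted-diagonal majorant `Σ_{a,b} |l α x′ a (z+t)|·C_V·C_r`.) -/
theorem push₃_transpose_ff (hls : ∀ α x' κ, Summable fun x => l α x' κ x) {Cr Cw : ℝ} (hr : ∀ β z' κ z, |r β z' κ z| ≤ Cr)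
    (hw : ∀ κ' u' κ u, |w κ' u' κ u| ≤ Cw) (κ' : Fin (d + 1)) (u' x' z' : Fin (d + 1) → ℤ) (α β : Fin (d + 1)) :
    push₃ l r w (wilsonA d) κ' u' x' z' (Sum.inl α) (Sum.inl β) = -push₃ r l w (wilsonA d) κ' u' z' x' (Sum.inl β) (Sum.inl α) := by
  classical
  have hCw : 0 ≤ Cw := (abs_nonneg _).trans (hw 0 0 0 0)
  have hCr : 0 ≤ Cr := (abs_nonneg _).trans (hr 0 0 0 0)
  -- the table vertex is bounded (cubic Wilson family is a `LocStencil` family at rate 1) and vanishes outside the window `cube 4`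
  have hV := decays_vertexW_of_locStencil hw hCw (locStencil_wilsonA (d := d) zero_le_one) one_pos κ' u'
  set CV : ℝ := (d + 1 : ℕ) * (Cw * (StepJetData.wBound d * Real.exp (4 * 1)) * Zl (d + 1) (1 / 2)) with hCV
  have hVb : ∀ x z a b, |vertexW w (wilsonA d) κ' u' x z a b| ≤ CV := fun x z a b => abs_le_of_decays hV one_half_pos.le x z a b
  have hCV0 : 0 ≤ CV := (abs_nonneg _).trans (hVb 0 0 (Sum.inl 0) (Sum.inl 0))
  -- finite support of the inner sums
  have hsxV : ∀ z a b, Summable fun x => l α x' a x * vertexW w (wilsonA d) κ' u' x z (Sum.inl a) (Sum.inl b) := by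
    intro z a b
    refine summable_of_ne_finset_zero (s := (cube (d + 1) 4).image fun t => z + t) fun x hx => ?_
    have hx' : x - z ∉ cube (d + 1) 4 := fun h => hx (Finset.mem_image.2 ⟨x - z, h, by abel⟩)
    rw [vertexW_wilsonA_ff_eq_zero_of_not_mem w κ' u' hx', mul_zero]
  have hszV : ∀ x a b, Summable fun z => r β z' b z * vertexW w (wilsonA d) κ' u' z x (Sum.inl b) (Sum.inl a) := by
    intro x a b
    refine summable_of_ne_finset_zero (s := (cube (d + 1) 4).image fun t => x + t) fun z hz => ?_
    have hz' : z - x ∉ cube (d + 1) 4 := fun h => hz (Finset.mem_image.2 ⟨z - x, h, by abel⟩)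
    rw [vertexW_wilsonA_ff_eq_zero_of_not_mem w κ' u' hz', mul_zero]
  -- Θ x z := Σ_a Σ_b l α x′ a x · V x z a b · r β z′ b z
  have h1 : ∀ z, (∑ b, (∑' x, ∑ a, l α x' a x * vertexW w (wilsonA d) κ' u' x z (Sum.inl a) (Sum.inl b)) * r β z' b z)
      = ∑' x, ∑ a, ∑ b, l α x' a x * vertexW w (wilsonA d) κ' u' x z (Sum.inl a) (Sum.inl b) * r β z' b z := by
    intro z
    calc (∑ b, (∑' x, ∑ a, l α x' a x * vertexW w (wilsonA d) κ' u' x z (Sum.inl a) (Sum.inl b)) * r β z' b z)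
        = ∑ b, ∑ a, ∑' x, l α x' a x * vertexW w (wilsonA d) κ' u' x z (Sum.inl a) (Sum.inl b) * r β z' b z := by
          refine Finset.sum_congr rfl fun b _ => ?_
          rw [Summable.tsum_finsetSum fun a _ => hsxV z a b, Finset.sum_mul]
          refine Finset.sum_congr rfl fun a _ => ?_
          rw [← tsum_mul_right]
      _ = ∑ b, ∑' x, ∑ a, l α x' a x * vertexW w (wilsonA d) κ' u' x z (Sum.inl a) (Sum.inl b) * r β z' b z := by
          refine Finset.sum_congr rfl fun b _ => ?_
          rw [Summable.tsum_finsetSum fun a _ => (hsxV z a b).mul_right _]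
      _ = ∑' x, ∑ b, ∑ a, l α x' a x * vertexW w (wilsonA d) κ' u' x z (Sum.inl a) (Sum.inl b) * r β z' b z := by
          rw [Summable.tsum_finsetSum fun b _ => summable_sum fun a _ => (hsxV z a b).mul_right _]
      _ = _ := tsum_congr fun x => Finset.sum_comm
  have h2 : ∀ x, (∑ a, (∑' z, ∑ b, r β z' b z * vertexW w (wilsonA d) κ' u' z x (Sum.inl b) (Sum.inl a)) * l α x' a x)
      = -∑' z, ∑ a, ∑ b, l α x' a x * vertexW w (wilsonA d) κ' u' x z (Sum.inl a) (Sum.inl b) * r β z' b z := by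
    intro x
    rw [← tsum_neg]
    calc (∑ a, (∑' z, ∑ b, r β z' b z * vertexW w (wilsonA d) κ' u' z x (Sum.inl b) (Sum.inl a)) * l α x' a x)
        = ∑ a, ∑ b, ∑' z, r β z' b z * vertexW w (wilsonA d) κ' u' z x (Sum.inl b) (Sum.inl a) * l α x' a x := by
          refine Finset.sum_congr rfl fun a _ => ?_
          rw [Summable.tsum_finsetSum fun b _ => hszV x a b, Finset.sum_mul]
          refine Finset.sum_congr rfl fun b _ => ?_
          rw [← tsum_mul_right]
      _ = ∑ a, ∑' z, ∑ b, r β z' b z * vertexW w (wilsonA d) κ' u' z x (Sum.inl b) (Sum.inl a) * l α x' a x := by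
          refine Finset.sum_congr rfl fun a _ => ?_
          rw [Summable.tsum_finsetSum fun b _ => (hszV x a b).mul_right _]
      _ = ∑' z, ∑ a, ∑ b, r β z' b z * vertexW w (wilsonA d) κ' u' z x (Sum.inl b) (Sum.inl a) * l α x' a x := by
          rw [Summable.tsum_finsetSum fun a _ => summable_sum fun b _ => (hszV x a b).mul_right _]
      _ = _ := by
          refine tsum_congr fun z => ?_
          rw [← Finset.sum_neg_distrib]
          refine Finset.sum_congr rfl fun a _ => ?_
          rw [← Finset.sum_neg_distrib]
          refine Finset.sum_congr rfl fun b _ => ?_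
          rw [vertexW_wilsonA_antisymm w κ' u' x z (Sum.inl a) (Sum.inl b)]
          ring
  rw [push₃_inl_inl, push₃_inl_inl, tsum_congr h1, tsum_congr h2, tsum_neg, neg_neg]
  -- the genuine exchange
  refine tsum_comm_of_window (Θ := fun x z => ∑ a, ∑ b, l α x' a x * vertexW w (wilsonA d) κ' u' x z (Sum.inl a) (Sum.inl b) * r β z' b z)
    (cube (d + 1) 4) (fun x z hxz => ?_) (fun t _ => ?_)
  · exact Finset.sum_eq_zero fun a _ => Finset.sum_eq_zero fun b _ => by
      rw [vertexW_wilsonA_ff_eq_zero_of_not_mem w κ' u' hxz, mul_zero, zero_mul]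
  · -- summable along the shifted diagonal: `|Θ (z+t) z| ≤ Σ_{a,b} |l α x′ a (z+t)|·C_V·C_r`
    have hls' : ∀ a, Summable fun z => |l α x' a (z + t)| * (CV * Cr) := by
      intro a
      have h := ((Equiv.addRight t).summable_iff.2 (hls α x' a)).abs.mul_right (CV * Cr)
      exact h.congr fun z => by simp only [Function.comp_apply, Equiv.coe_addRight]
    have hg : Summable fun z => ∑ a : Fin (d + 1), ∑ _b : Fin (d + 1), |l α x' a (z + t)| * (CV * Cr) :=
      summable_sum fun a _ => summable_sum fun _ _ => hls' a
    refine Summable.of_norm_bounded hg (fun z => ?_)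
    rw [Real.norm_eq_abs]
    refine (Finset.abs_sum_le_sum_abs _ _).trans (Finset.sum_le_sum fun a _ => ?_)
    refine (Finset.abs_sum_le_sum_abs _ _).trans (Finset.sum_le_sum fun b _ => ?_)
    rw [abs_mul, abs_mul, mul_assoc]
    exact mul_le_mul_of_nonneg_left (mul_le_mul (hVb _ _ _ _) (hr β z' b z) (abs_nonneg _) hCV0) (abs_nonneg _)

/-- [folklore] **THE RIGHT SLOT** on the summable class (left legs `l` with SUMMABLE fine rows, table legs `w` BOUNDED, the gauge increments `dz (λ μ y)`
BOUNDED): with a pure-gauge RIGHT leg family, every field entry of the push is MINUS leaf-02's first-slot cell sum WITH THE LEGS EXCHANGED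
(`cell_eq'` with `T₃ = l α x′` OUTER, `T₁ = w κ′ u′` INSIDE, `ψ = λ β z′`):
`push₃ l (dz λ) w (wilsonA d) κ′ u′ x′ z′ (inl α) (inl β) = −Σ'_x Σ_a l α x′ a x · Σ'_u Σ_κ w κ′ u′ κ u · (½(λ_{βz′}(u+e_κ) − ½(λ_{βz′} x + λ_{βz′}(x+e_a)))·(d*dδ_{(κ,u)})_a x)`. -/
theorem push₃_gaugeRight_ff (hls : ∀ α x' κ, Summable fun x => l α x' κ x) {Cg Cw : ℝ} (hlam : ∀ μ y κ u, |dz (lam μ y) κ u| ≤ Cg)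
    (hw : ∀ κ' u' κ u, |w κ' u' κ u| ≤ Cw) (κ' : Fin (d + 1)) (u' x' z' : Fin (d + 1) → ℤ) (α β : Fin (d + 1)) :
    push₃ l (fun μ y κ u => dz (lam μ y) κ u) w (wilsonA d) κ' u' x' z' (Sum.inl α) (Sum.inl β)
      = -∑' x, ∑ a, l α x' a x * ∑' u, ∑ κ, w κ' u' κ u *
          ((1 / 2 : ℝ) * (lam β z' (u + unitVec κ) - (lam β z' x + lam β z' (x + unitVec a)) / 2) * curvAdj (curv (delta1 κ u)) a x) := by
  rw [push₃_transpose_ff (r := fun μ y κ u => dz (lam μ y) κ u) hls hlam hw, push₃_gaugeLeft_ff]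

end Summit.QuantumFields.BalabanUV.Beta.GAN24.Push3GaugeSlotCells

end
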